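import Literature.AlgebraicGeometry.Resolution.NormalDegreePDefectless
import Literature.AlgebraicGeometry.Resolution.ResidueTranscendentalExtensions
import Literature.AlgebraicGeometry.Resolution.NagataIntersection
import Mathlib.FieldTheory.PurelyInseparable.PerfectClosure
import HarnessLib

/-!
# Purely inseparable extensions of degree `p` of henselized inertially generated function fields are defectless (Kuhlmann 2010, §5 p. 20 with Prop. 3.1) — proof

Topic: `Literature/AlgebraicGeometry/Resolution` (valued function fields). DISCHARGE of the named
fact `Kuhlmann2010PurelyInseparableDegreePDefectless` (`NormalDegreePDefectless.lean`), the purely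
inseparable half of "By Corollary 4.2 or Proposition 3.1, this extension is defectless" (F.-V.
Kuhlmann, *Elimination of ramification I: The generalized stability theorem*, Trans. AMS 362
(2010) 5697–5727 = arXiv:1003.5678, §5, proof of (R4), p. 20): for `N` a henselized inertially
generated function field of rank one with a residue-transcendental generator `x` over an
algebraically closed `K` (`IsHenselizedInertiallyGeneratedRT`, i.e. `N` finite unramified over
`K(x)^h`) inside the algebraically closed `(Ω, V)` with `char Ωv = p`, and `N ≤ N'` purely
inseparable of degree `p`, `[N' : N] = (vN' : vN)·[N'v : Nv]`.

The source obtains this from Prop. 3.1 (the "inseparably defectless" Generalized Stability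
Theorem, whose proof computes `[E : K(𝒯)]` for `E = K'(𝒯^{1/p^m})`: "the residues
`ȳᵢ^{1/p^m}` … are still algebraically independent … `[E:K(𝒯)] = … = (vE:vK(𝒯))·[Ē:K(𝒯)‾]`")
transported to the henselization by Thm. 2.14 and Lemma 2.3. The proof given here is the same
computation carried out directly for the one purely inseparable extension of degree `p` of `N`,
which is `N(x^{1/p})`:

* `char Ω = p` (a purely inseparable extension of prime degree `p` exists), and every `w ∈ N'`
  has `w^p ∈ N` (`pow_mem_of_purelyInseparable_of_finrank_eq`);
* `N|K(x)` is separable: `K(x)^h|K(x)` is (the henselization lies in the separable closure) and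
  the finite unramified `N|K(x)^h` is (`IsUnramifiedOver.isSeparable`: the maximal separable
  subextension `S` has `Nv = Sv`, so `[N : K(x)^h] = [Nv : …] ≤ [S : K(x)^h]`);
* hence, with `t^p = x`, `N' ⊆ N(t)`: for `w ∈ N'`, `w^p ∈ K(x)(w^p) = K(x)(w^{p²}) ⊆ (N(t))^p`
  (`K = K^p`, `x = t^p`) and Frobenius is injective (`le_adjoin_of_pow_mem_of_isSeparable`); as
  `[N(t) : N] ≤ p = [N' : N]`, `N' = N(t)` and `t ∈ N'`;
* `t̄^p = x̄` and `x̄` is not a `p`-th power in `Nv` — `Nv` is separable over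
  `K(x)^h v = K(x)v = Kv(x̄)` (Lemma 2.2, Lemma 2.5) and `x̄` is transcendental over `Kv`
  (`residue_pow_ne_of_isResidueTranscendental`) —, so `[N'v : Nv] ≥ [Nv(t̄) : Nv] = p`;
* `vN' = vN = vK` is divisible (Lemma 2.1, §2.5; `ResidueTranscendentalExtensions.lean`), so
  `(vN' : vN) = 1`, and the fundamental inequality `(vN' : vN)·[N'v : Nv] ≤ [N' : N] = p` gives
  `[N'v : Nv] = p`: the extension is defectless.

## Content (everything PROVED)

* Field lemmas: `pow_ne_of_transcendental_of_mem_adjoin` (a transcendental `y` is no `n`-th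
  power in `F(y)`, `n ≠ 1`), `mem_range_of_isSeparable_of_pow_mem` (separable with a `qⁿ`-th
  power in the base lies in the base), `charP_of_purelyInseparable_of_finrank_eq`,
  `pow_mem_of_purelyInseparable_of_finrank_eq`.
* `IsUnramifiedOver.isSeparable` — finite unramified extensions (inside `(Ω, V)`) are separable.
* `le_adjoin_of_pow_mem_of_isSeparable`, `adjoin_le_map_frobenius`,
  `mem_of_le_adjoin_of_finrank_eq` — `N' = N(x^{1/p})`.
* `residue_pow_ne_of_isResidueTranscendental` — `x̄ ∉ (Nv)^p`.
* `isDefectlessExtension_of_purelyInseparable` and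
  `Kuhlmann2010PurelyInseparableDegreePDefectless_holds`.

## Sources

* F.-V. Kuhlmann, *Elimination of ramification I: The generalized stability theorem*, Trans.
  Amer. Math. Soc. 362 (2010) 5697–5727 = arXiv:1003.5678: §1 (1) (fundamental inequality),
  §2.1 (Lemmas 2.1, 2.2, 2.5), §2.5, §3 Prop. 3.1 (and its proof), §5 proof of (R4), p. 20.
-/

noncomputable section

open IsLocalRing Polynomial

namespace Literature.AlgebraicGeometry.Resolution

universe u

/-! ### Field-theoretic lemmas -/

section FieldLemmas

variable {F E : Type*} [Field F] [Field E] [Algebra F E]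

/-- **A transcendental `y` is not an `n`-th power in `F(y)` for `n ≠ 1`**: writing an element of
`F(y)` as `r(y)/s(y)`, `r^n = X·s^n` in `F[X]` forces `n ∣ 1`. [folklore] -/
theorem pow_ne_of_transcendental_of_mem_adjoin {y : E} (hy : Transcendental F y) {n : ℕ}
    (hn : n ≠ 1) {s : E} (hs : s ∈ IntermediateField.adjoin F {y}) : s ^ n ≠ y := by
  obtain ⟨r, q, rfl⟩ := (IntermediateField.mem_adjoin_simple_iff F _).mp hs
  intro h
  have hy0 : y ≠ 0 := fun h0 => hy (h0 ▸ isAlgebraic_zero)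
  have hy1 : y ≠ 1 := fun h1 => hy (h1 ▸ isAlgebraic_one)
  by_cases hq : aeval y q = 0
  · rw [hq, div_zero] at h
    rcases Nat.eq_zero_or_pos n with hn0 | hnpos
    · rw [hn0, pow_zero] at h
      exact hy1 h.symm
    · rw [zero_pow hnpos.ne'] at h
      exact hy0 h.symm
  · have hinj := transcendental_iff_injective.mp hy
    have h1 : (aeval y r) ^ n = y * (aeval y q) ^ n := by
      rw [div_pow, div_eq_iff (pow_ne_zero n hq)] at h
      exact h
    have h2 : aeval y (r ^ n) = aeval y (X * q ^ n) := by
      rw [map_pow, map_mul, map_pow, aeval_X]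
      exact h1
    have h3 : r ^ n = X * q ^ n := hinj h2
    have hq0 : q ≠ 0 := fun h0 => hq (by rw [h0, map_zero])
    have hdeg := congrArg natDegree h3
    rw [natDegree_pow, natDegree_X_mul (pow_ne_zero n hq0), natDegree_pow] at hdeg
    have hdvd : n ∣ 1 := by
      have h1 : n ∣ n * q.natDegree + 1 := ⟨r.natDegree, hdeg.symm⟩
      exact (Nat.dvd_add_right (dvd_mul_right n _)).mp h1
    exact hn (Nat.dvd_one.mp hdvd)

/-- **Separable and a `qⁿ`-th power in the base ⇒ in the base** (`q` the exponential
characteristic): `F(s) = F(s^{qⁿ}) = F`. [folklore] -/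
theorem mem_range_of_isSeparable_of_pow_mem (q : ℕ) [ExpChar F q] {s : E} (hsep : IsSeparable F s)
    (n : ℕ) (hs : s ^ q ^ n ∈ Set.range (algebraMap F E)) : s ∈ Set.range (algebraMap F E) := by
  have h := IntermediateField.adjoin_simple_eq_adjoin_pow_expChar_pow_of_isSeparable F E hsep q n
  have hbot : IntermediateField.adjoin F {s ^ q ^ n} = ⊥ :=
    IntermediateField.adjoin_simple_eq_bot_iff.mpr (IntermediateField.mem_bot.mpr hs)
  rw [hbot] at h
  exact IntermediateField.mem_bot.mp (h ▸ IntermediateField.mem_adjoin_simple_self F s)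

end FieldLemmas

variable {Ω : Type u} [Field Ω]

/-! ### Subfields of a field of characteristic `p` -/

section Subfields

/-- Range of `algebraMap M Ω` for a subfield `M`, membership form. [folklore] -/
theorem mem_range_algebraMap_subfield_iff' (M : Subfield Ω) (a : Ω) :
    a ∈ Set.range (algebraMap M Ω) ↔ a ∈ M := by
  rw [range_algebraMap_subfield]
  rfl

/-- **A purely inseparable step of prime degree `p` forces characteristic `p`**: an element
outside the base has minimal polynomial `X^{qⁿ} - c` (`q` the exponential characteristic) of
degree `qⁿ > 1` dividing `p`, so `q = p` and `char = p`. [folklore] -/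
theorem charP_of_purelyInseparable_of_finrank_eq {p : ℕ} (hp : p.Prime) {M : Subfield Ω}
    (T : IntermediateField M Ω) (hdeg : Module.finrank M T = p) [IsPurelyInseparable M T] :
    CharP Ω p := by
  obtain ⟨q, hq⟩ := ExpChar.exists M
  haveI : FiniteDimensional M T := Module.finite_of_finrank_pos (by rw [hdeg]; exact hp.pos)
  -- an element of `T` outside `M`
  have hT : T ≠ ⊥ := by
    intro h
    rw [h, IntermediateField.finrank_bot] at hdeg
    exact hp.one_lt.ne hdeg
  obtain ⟨z, hzT, hzM⟩ : ∃ z : Ω, z ∈ T ∧ z ∉ (⊥ : IntermediateField M Ω) := by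
    by_contra hcon
    push Not at hcon
    exact hT (le_antisymm (fun z hz => hcon z hz) bot_le)
  -- its minimal polynomial is `X^{qⁿ} - c`, of degree `qⁿ ∣ p`
  obtain ⟨n, c, hmin⟩ := IsPurelyInseparable.minpoly_eq_X_pow_sub_C M q (⟨z, hzT⟩ : T)
  have hint : IsIntegral M (⟨z, hzT⟩ : T) := Algebra.IsIntegral.isIntegral _
  have hdvd : q ^ n ∣ p := by
    have h1 : Module.finrank M (IntermediateField.adjoin M {(⟨z, hzT⟩ : T)}) = q ^ n := by
      rw [IntermediateField.adjoin.finrank hint, hmin, natDegree_X_pow_sub_C]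
    rw [← h1, ← hdeg, ← IntermediateField.finrank_top' (F := M) (E := T)]
    exact IntermediateField.finrank_dvd_of_le_right le_top
  have hne1 : q ^ n ≠ 1 := by
    intro h1
    have hdeg1 : (minpoly M (⟨z, hzT⟩ : T)).natDegree = 1 := by
      rw [hmin, natDegree_X_pow_sub_C, h1]
    -- degree one: `z ∈ M`
    have hzmem : (⟨z, hzT⟩ : T) ∈ (⊥ : IntermediateField M T) := by
      rw [← IntermediateField.adjoin_simple_eq_bot_iff, ← IntermediateField.finrank_eq_one_iff,
        IntermediateField.adjoin.finrank hint, hdeg1]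
    obtain ⟨m, hm⟩ := IntermediateField.mem_bot.mp hzmem
    apply hzM
    rw [IntermediateField.mem_bot]
    exact ⟨m, congrArg (fun w : T => (w : Ω)) hm⟩
  -- hence `q ^ n = p`, `q = p`
  have hqn : q ^ n = p := (Nat.dvd_prime hp).mp hdvd |>.resolve_left hne1
  have hn0 : n ≠ 0 := by
    rintro rfl
    rw [pow_zero] at hne1
    exact hne1 rfl
  have hqp : q = p := by
    have hqdvd : q ∣ p := hqn ▸ dvd_pow_self q hn0
    rcases (Nat.dvd_prime hp).mp hqdvd with h1 | h2
    · exfalso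
      rw [h1, one_pow] at hne1
      exact hne1 rfl
    · exact h2
  subst hqp
  -- `ExpChar M q` with `q` prime: `CharP M q`
  haveI : CharP M q := by
    cases hq with
    | zero => exact absurd rfl hp.ne_one
    | prime h => infer_instance
  exact charP_of_injective_ringHom (algebraMap M Ω).injective q

end Subfields

/-! ### Unramified extensions are separable -/

section Unramified

variable (V : ValuationSubring Ω)

/-- **A finite unramified extension is separable** (inside `(Ω, V)`): if `N|H` is finite with
`[N : H] = [Nv : Hv]` and `Nv|Hv` separable (`IsUnramifiedOver`), then every element of `N` is
separable over `H`. Indeed, for the maximal separable subextension `S`, `N|S` is purely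
inseparable, so `Nv|Sv` is purely inseparable and separable, i.e. `Nv = Sv`; then
`[N : H] = [Nv : Hv] = [Sv : Hv] ≤ [S : H]` forces `S = N`. [folklore] -/
theorem IsUnramifiedOver.isSeparable {H N : Subfield Ω} (h : IsUnramifiedOver V H N) {z : Ω}
    (hz : z ∈ N) : IsSeparable H z := by
  obtain ⟨hle, hpos, hdeg, hsep, -⟩ := h
  set T : IntermediateField H Ω := Subfield.extendScalars hle with hT
  have hfr : Subfield.relfinrank H N = Module.finrank H T := Subfield.relfinrank_eq_finrank_of_le hle
  haveI : FiniteDimensional H T := by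
    rw [hfr] at hpos
    exact Module.finite_of_finrank_pos hpos
  haveI : Algebra.IsAlgebraic H T := Algebra.IsAlgebraic.of_finite H T
  -- it suffices to treat `z` as an element of `T`
  suffices hzT : IsSeparable H (⟨z, hz⟩ : T) by
    have := hzT.map (IsScalarTower.toAlgHom H T Ω) (algebraMap T Ω).injective
    exact this
  obtain ⟨q, hq⟩ := ExpChar.exists H
  rcases hq with _ | hprime
  · -- characteristic `0`: everything is separable
    exact Algebra.IsSeparable.isSeparable H _
  · -- characteristic `q` prime
    rename_i q _
    haveI : CharP Ω q := charP_of_injective_ringHom (algebraMap H Ω).injective q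
    haveI : ExpChar Ω q := ExpChar.prime hprime
    -- the residue field has characteristic `q` as well
    haveI : CharP (ResidueField V) q := by
      rw [CharP.charP_iff_prime_eq_zero hprime]
      haveI : CharP V q := V.subtype.charP Subtype.val_injective q
      have h0 : algebraMap V (ResidueField V) (q : V) = 0 := by
        rw [CharP.cast_eq_zero, map_zero]
      rw [← map_natCast (algebraMap V (ResidueField V)) q]
      exact h0
    haveI : ExpChar (ResidueField V) q := ExpChar.prime hprime
    -- the maximal separable subextension `S`, as a subfield of `Ω`
    set S : IntermediateField H Ω := IntermediateField.lift (separableClosure H T) with hS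
    have hST : S ≤ T := IntermediateField.lift_le _
    have hHS : H ≤ S.toSubfield := subfield_le_toSubfield S
    have hSN : S.toSubfield ≤ N := fun a ha => (Subfield.mem_extendScalars (h := hle)).mp (hST ha)
    -- `N|S` is purely inseparable: every element has a `qⁿ`-th power in `S`
    have hpow : ∀ a ∈ N, ∃ n : ℕ, a ^ q ^ n ∈ S.toSubfield := by
      intro a ha
      haveI : ExpChar (separableClosure H T) q :=
        expChar_of_injective_ringHom (algebraMap H (separableClosure H T)).injective q
      obtain ⟨n, y, hy⟩ := IsPurelyInseparable.pow_mem (separableClosure H T) q (⟨a, ha⟩ : T)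
      refine ⟨n, ?_⟩
      have hy' : ((y : T) : Ω) = a ^ q ^ n := by
        have := congrArg (fun w : T => (w : Ω)) hy
        simpa using this
      rw [← hy']
      exact (IntermediateField.mem_lift (y : T)).mpr y.2
    -- hence `Nv = Sv`
    have hres : residueSubfield N V = residueSubfield S.toSubfield V := by
      refine le_antisymm (fun r hr => ?_) (residueSubfield_subfield_mono hSN)
      have hr' := hr
      rw [residueSubfield_subfield_eq_resField] at hr'
      obtain ⟨a, haN, rfl⟩ := (mem_resField_iff V N _).mp hr'
      obtain ⟨n, hn⟩ := hpow a haN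
      -- `r^{qⁿ} ∈ Sv`
      have hrn : residue V a ^ q ^ n ∈ residueSubfield S.toSubfield V := by
        rw [residueSubfield_subfield_eq_resField, ← map_pow]
        exact residue_mem_resField V (a ^ q ^ n) hn
      -- `r` is separable over `Hv ≤ Sv`
      have hsepS : IsSeparable (residueSubfield S.toSubfield V) (residue V a) :=
        isSeparable_of_subfield_le (residueSubfield_subfield_mono hHS) (hsep _ hr)
      haveI : ExpChar (residueSubfield S.toSubfield V) q :=
        (algebraMap (residueSubfield S.toSubfield V) (ResidueField V)).expChar
          (algebraMap (residueSubfield S.toSubfield V) (ResidueField V)).injective q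
      have hmem := mem_range_of_isSeparable_of_pow_mem q hsepS n
        ((mem_range_algebraMap_subfield_iff' _ _).mpr hrn)
      exact (mem_range_algebraMap_subfield_iff' _ _).mp hmem
    -- degrees: `[N : H] = [Nv : Hv] = [Sv : Hv] ≤ [S : H]`
    haveI : FiniteDimensional H S :=
      Module.Finite.equiv (IntermediateField.liftAlgEquiv (separableClosure H T)).toLinearEquiv
    have hposS : 0 < Subfield.relfinrank H S.toSubfield := by
      rw [Subfield.relfinrank_eq_finrank_of_le hHS, extendScalars_toSubfield_eq S hHS]
      exact Module.finrank_pos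
    obtain ⟨heS, -, hefS⟩ := relIndex_mul_relfinrank_le_relfinrank V hHS hposS
    have h1 : Subfield.relfinrank H N ≤ Subfield.relfinrank H S.toSubfield := by
      rw [hdeg, hres]
      exact le_trans (Nat.le_mul_of_pos_left _ heS) hefS
    have hmul := Subfield.relfinrank_mul_relfinrank hHS hSN
    have hposSN : 0 < Subfield.relfinrank S.toSubfield N := by
      rcases Nat.eq_zero_or_pos (Subfield.relfinrank S.toSubfield N) with h0 | h0
      · rw [h0, mul_zero] at hmul
        rw [← hmul] at hpos
        exact absurd hpos (lt_irrefl 0)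
      · exact h0
    have hSN1 : Subfield.relfinrank S.toSubfield N = 1 := by
      have h2 : Subfield.relfinrank H S.toSubfield * Subfield.relfinrank S.toSubfield N ≤
          Subfield.relfinrank H S.toSubfield * 1 := by
        rw [hmul, mul_one]
        exact h1
      exact le_antisymm (Nat.le_of_mul_le_mul_left h2 hposS) hposSN
    have hNS : N ≤ S.toSubfield := (Subfield.relfinrank_eq_one_iff).mp hSN1
    -- so `z ∈ S` is separable over `H`
    have hzS : (⟨z, hz⟩ : T) ∈ separableClosure H T :=
      (IntermediateField.mem_lift (⟨z, hz⟩ : T)).mp (hNS hz)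
    exact mem_separableClosure_iff.mp hzS

end Unramified

/-! ### `p`-th roots: `N' ⊆ N(t)` and `t ∈ N'` -/

section PthRoots

/-- **If `N|F₀` is separable and `F₀ ⊆ (N(t))^p`, then every `w` with `w^p ∈ N` lies in
`N(t)`**: `w^p ∈ F₀(w^p) = F₀(w^{p²}) ⊆ (N(t))^p`, and Frobenius is injective. [folklore] -/
theorem le_adjoin_of_pow_mem_of_isSeparable (p : ℕ) [ExpChar Ω p] {F₀ N N' : Subfield Ω} {t : Ω}
    (hpow : ∀ w ∈ N', w ^ p ∈ N) (hsep : ∀ z ∈ N, IsSeparable F₀ z)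
    (hF₀ : F₀ ≤ ((IntermediateField.adjoin N ({t} : Set Ω)).toSubfield).map (frobenius Ω p)) :
    N' ≤ (IntermediateField.adjoin N ({t} : Set Ω)).toSubfield := by
  intro w hw
  set Nt : Subfield Ω := (IntermediateField.adjoin N ({t} : Set Ω)).toSubfield with hNt
  have hNNt : N ≤ Nt := subfield_le_toSubfield _
  have hz : w ^ p ∈ N := hpow w hw
  haveI : ExpChar F₀ p := (algebraMap F₀ Ω).expChar (algebraMap F₀ Ω).injective p
  -- `w^p ∈ F₀(w^{p²})`
  have key : w ^ p ∈ IntermediateField.adjoin F₀ {(w ^ p) ^ p} := by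
    rw [← IntermediateField.adjoin_simple_eq_adjoin_pow_expChar_of_isSeparable F₀ Ω (hsep _ hz) p]
    exact IntermediateField.mem_adjoin_simple_self F₀ (w ^ p)
  -- `F₀(w^{p²}) ⊆ (N(t))^p`
  have hle : (IntermediateField.adjoin F₀ {(w ^ p) ^ p}).toSubfield ≤ Nt.map (frobenius Ω p) := by
    rw [IntermediateField.adjoin_toSubfield, Subfield.closure_le, range_algebraMap_subfield]
    rintro a (ha | ha)
    · exact hF₀ ha
    · rw [Set.mem_singleton_iff] at ha
      subst ha
      exact Subfield.mem_map.mpr ⟨w ^ p, hNNt hz, frobenius_def p (w ^ p)⟩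
  have hmem : w ^ p ∈ Nt.map (frobenius Ω p) := hle key
  obtain ⟨u, hu, hu'⟩ := Subfield.mem_map.mp hmem
  have huw : u = w := frobenius_inj Ω p (by rw [hu', frobenius_def])
  rw [← huw]
  exact hu

/-- **`K(x) ⊆ (N(t))^p` for `K ≤ N` perfect (algebraically closed) and `t^p = x`.** [folklore] -/
theorem adjoin_le_map_frobenius (p : ℕ) [ExpChar Ω p] (hp : 0 < p) {K N : Subfield Ω}
    (hK : IsAlgClosed K) (hKN : K ≤ N) {x t : Ω} (htx : t ^ p = x) :
    (IntermediateField.adjoin K ({x} : Set Ω)).toSubfield ≤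
      ((IntermediateField.adjoin N ({t} : Set Ω)).toSubfield).map (frobenius Ω p) := by
  haveI := hK
  rw [IntermediateField.adjoin_toSubfield, Subfield.closure_le, range_algebraMap_subfield]
  rintro a (ha | ha)
  · -- `a ∈ K` is a `p`-th power in `K`
    obtain ⟨d, hd⟩ := IsAlgClosed.exists_pow_nat_eq (⟨a, ha⟩ : K) hp
    refine Subfield.mem_map.mpr ⟨(d : Ω), subfield_le_toSubfield _ (hKN d.2), ?_⟩
    rw [frobenius_def]
    have := congrArg (fun c : K => (c : Ω)) hd
    simpa using this
  · rw [Set.mem_singleton_iff] at ha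
    subst ha
    exact Subfield.mem_map.mpr
      ⟨t, IntermediateField.subset_adjoin N ({t} : Set Ω) rfl, by rw [frobenius_def, htx]⟩

/-- **`t ∈ N'` when `N' ⊆ N(t)`, `[N' : N] = p` and `t^p ∈ N`**: `[N(t) : N] ≤ p = [N' : N]`
forces `N' = N(t)`. [folklore] -/
theorem mem_of_le_adjoin_of_finrank_eq (p : ℕ) [Fact p.Prime] [CharP Ω p] {N N' : Subfield Ω}
    {t : Ω} (hNN' : N ≤ N') (hdeg : Module.finrank N (Subfield.extendScalars hNN') = p)
    (htp : t ^ p ∈ N) (hle : N' ≤ (IntermediateField.adjoin N ({t} : Set Ω)).toSubfield) :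
    t ∈ N' := by
  have hp : p.Prime := Fact.out
  have hint : IsIntegral N t :=
    IsIntegral.of_pow hp.pos (isIntegral_algebraMap (R := N) (A := Ω) (x := ⟨t ^ p, htp⟩))
  haveI : FiniteDimensional N (IntermediateField.adjoin N ({t} : Set Ω)) :=
    IntermediateField.adjoin.finiteDimensional hint
  have hfin : Module.finrank N (IntermediateField.adjoin N ({t} : Set Ω)) ≤ p :=
    finrank_adjoin_simple_le_of_pow_mem_range p ⟨⟨t ^ p, htp⟩, rfl⟩
  have hTNt : Subfield.extendScalars hNN' ≤ IntermediateField.adjoin N ({t} : Set Ω) :=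
    fun a ha => hle ((Subfield.mem_extendScalars (h := hNN')).mp ha)
  have heq : Subfield.extendScalars hNN' = IntermediateField.adjoin N ({t} : Set Ω) :=
    IntermediateField.eq_of_le_of_finrank_le hTNt (by rw [hdeg]; exact hfin)
  have ht : t ∈ IntermediateField.adjoin N ({t} : Set Ω) := IntermediateField.mem_adjoin_simple_self N t
  rw [← heq, Subfield.mem_extendScalars] at ht
  exact ht

end PthRoots

/-- **In a purely inseparable step of degree `p`, every element has its `p`-th power in the
base**: the minimal polynomial `X^{pⁿ} - c` has degree `pⁿ ≤ p`. [folklore] -/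
theorem pow_mem_of_purelyInseparable_of_finrank_eq (p : ℕ) [Fact p.Prime] [CharP Ω p]
    {N N' : Subfield Ω} (hNN' : N ≤ N') (hdeg : Module.finrank N (Subfield.extendScalars hNN') = p)
    [IsPurelyInseparable N (Subfield.extendScalars hNN')] {w : Ω} (hw : w ∈ N') : w ^ p ∈ N := by
  have hp : p.Prime := Fact.out
  haveI : ExpChar N p := (algebraMap N Ω).expChar (algebraMap N Ω).injective p
  haveI : FiniteDimensional N (Subfield.extendScalars hNN') :=
    Module.finite_of_finrank_pos (by rw [hdeg]; exact hp.pos)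
  have hw' : w ∈ Subfield.extendScalars hNN' := (Subfield.mem_extendScalars (h := hNN')).mpr hw
  obtain ⟨n, c, hmin⟩ :=
    IsPurelyInseparable.minpoly_eq_X_pow_sub_C N p (⟨w, hw'⟩ : Subfield.extendScalars hNN')
  have hle : p ^ n ≤ p ^ 1 := by
    have := minpoly.natDegree_le (A := N) (⟨w, hw'⟩ : Subfield.extendScalars hNN')
    rw [hmin, natDegree_X_pow_sub_C, hdeg] at this
    rw [pow_one]
    exact this
  have hn : n ≤ 1 := (Nat.pow_le_pow_iff_right hp.one_lt).mp hle
  have hroot : (⟨w, hw'⟩ : Subfield.extendScalars hNN') ^ p ^ n = algebraMap N _ c := by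
    have := minpoly.aeval N (⟨w, hw'⟩ : Subfield.extendScalars hNN')
    rw [hmin, map_sub, aeval_C, map_pow, aeval_X, sub_eq_zero] at this
    exact this
  have hwn : w ^ p ^ n = algebraMap N Ω c := by
    have := congrArg (fun z : Subfield.extendScalars hNN' => (z : Ω)) hroot
    simpa using this
  interval_cases n
  · rw [pow_zero, pow_one] at hwn
    rw [hwn]
    exact N.pow_mem c.2 p
  · rw [pow_one] at hwn
    rw [hwn]
    exact c.2

/-! ### The residue of `x^{1/p}` has degree `p` over `Nv` -/

section Residue

variable (V : ValuationSubring Ω)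

/-- **`x̄` is not a `p`-th power in `Nv`** for `N` finite unramified over `K(x)^h`, `x`
residue-transcendental over `K`: `Nv` is separable over `K(x)^h v = K(x)v = Kv(x̄)` (Lemma 2.2,
Lemma 2.5), so a `p`-th root of `x̄` in `Nv` would lie in `Kv(x̄)`, where `x̄` is transcendental.
[folklore] -/
theorem residue_pow_ne_of_isResidueTranscendental [IsAlgClosed Ω] (p : ℕ) (hp : p.Prime)
    [CharP (ResidueField V) p] {K N : Subfield Ω} {x : Ω} (hx : IsResidueTranscendental V K x)
    (hunr : IsUnramifiedOver V
      (henselization V (IntermediateField.adjoin K ({x} : Set Ω)).toSubfield) N)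
    {s : ResidueField V} (hs : s ∈ residueSubfield N V) : s ^ p ≠ residue V ⟨x, hx.mem⟩ := by
  intro hsp
  haveI : ExpChar (ResidueField V) p := ExpChar.prime hp
  set Kx : Subfield Ω := (IntermediateField.adjoin K ({x} : Set Ω)).toSubfield with hKxdef
  -- `K(x)^h v = K(x)v = Kv(x̄)`
  have hH : residueSubfield (henselization V Kx) V = residueSubfield Kx V :=
    (IsImmediateOver.valueSubgroup_eq_and_residueSubfield_eq V (le_henselization V Kx)
      (Kuhlmann2010HenselizationImmediate_holds Ω V Kx)).2
  have hKx : residueSubfield Kx V =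
      Subfield.closure ((residueSubfield K V : Set (ResidueField V)) ∪ {residue V ⟨x, hx.mem⟩}) :=
    residueSubfield_adjoin_eq_of_isResidueTranscendental V hx
  set A : Subfield (ResidueField V) :=
    Subfield.closure ((residueSubfield K V : Set (ResidueField V)) ∪ {residue V ⟨x, hx.mem⟩}) with hA
  -- `s` is separable over `A`, and `s^p = x̄ ∈ A`, so `s ∈ A`
  have hsepA : IsSeparable A s := isSeparable_of_subfield_le (hH.trans hKx).le (hunr.2.2.2.1 s hs)
  have hxA : residue V ⟨x, hx.mem⟩ ∈ A := Subfield.subset_closure (Or.inr rfl)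
  haveI : ExpChar A p := (algebraMap A (ResidueField V)).expChar (algebraMap A (ResidueField V)).injective p
  have hsA : s ∈ A := by
    have h1 : s ^ p ^ 1 ∈ Set.range (algebraMap A (ResidueField V)) := by
      rw [pow_one, hsp]
      exact (mem_range_algebraMap_subfield_iff' A _).mpr hxA
    exact (mem_range_algebraMap_subfield_iff' A s).mp (mem_range_of_isSeparable_of_pow_mem p hsepA 1 h1)
  -- `A = Kv(x̄)` with `x̄` transcendental over `Kv`
  have hsadj : s ∈ IntermediateField.adjoin (resField V K) ({residue V ⟨x, hx.mem⟩} : Set (ResidueField V)) := by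
    rw [mem_adjoin_subfield_iff, ← residueSubfield_subfield_eq_resField]
    exact hsA
  exact pow_ne_of_transcendental_of_mem_adjoin hx.2 hp.ne_one hsadj hsp

end Residue

/-! ### The purely inseparable case -/

section Main

variable (V : ValuationSubring Ω)

/-- **Kuhlmann 2010, p. 20 ("By … Proposition 3.1, this extension is defectless"), the purely
inseparable steps, PROVED directly**: for `N` in the class `IsHenselizedInertiallyGeneratedRT V K`
over an algebraically closed `K` and `N ≤ N'` purely inseparable of degree `p = char Ωv`,
`[N' : N] = (vN' : vN)·[N'v : Nv]`. Proof: `char Ω = p`; `N|K(x)` is separable (unramified over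
the henselization, `IsUnramifiedOver.isSeparable`), so with `t = x^{1/p}`: `N' ⊆ N(t)`, hence
`N' = N(t)` by degrees; `t̄ = x̄^{1/p}` has degree `p` over `Nv` (`x̄` is no `p`-th power in
`Nv`), so `[N'v : Nv] ≥ p`; and `vN' = vN = vK` (divisible). With `e·f ≤ p`: `e = 1`, `f = p`.
[cite: Kuhlmann2010, Section 5, proof of (R4) (p. 20), with Prop. 3.1] -/
theorem isDefectlessExtension_of_purelyInseparable [IsAlgClosed Ω] {p : ℕ}
    [CharP (ResidueField V) p] (hp : p.Prime) {K N N' : Subfield Ω} (hK : IsAlgClosed K)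
    (hN : IsHenselizedInertiallyGeneratedRT V K N) (hNN' : N ≤ N')
    (hdeg : Module.finrank N (Subfield.extendScalars hNN') = p)
    (hpi : IsPurelyInseparable N (Subfield.extendScalars hNN')) : IsDefectlessExtension V N N' := by
  haveI : Fact p.Prime := ⟨hp⟩
  haveI := hpi
  obtain ⟨x, hx, hr1, hunr⟩ := hN
  set Kx : Subfield Ω := (IntermediateField.adjoin K ({x} : Set Ω)).toSubfield with hKxdef
  set H : Subfield Ω := henselization V Kx with hHdef
  -- characteristic `p`
  haveI : CharP Ω p := charP_of_purelyInseparable_of_finrank_eq hp _ hdeg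
  haveI : ExpChar Ω p := ExpChar.prime hp
  -- inclusions
  have hKKx : K ≤ Kx := subfield_le_toSubfield _
  have hKxH : Kx ≤ H := le_henselization V Kx
  have hHN : H ≤ N := hunr.le
  have hKN : K ≤ N := hKKx.trans (hKxH.trans hHN)
  have hxKx : x ∈ Kx := IntermediateField.subset_adjoin K ({x} : Set Ω) rfl
  have hxN : x ∈ N := hHN (hKxH hxKx)
  -- degrees
  have hrel : Subfield.relfinrank N N' = p := by
    rw [Subfield.relfinrank_eq_finrank_of_le hNN', hdeg]
  have hpos : 0 < Subfield.relfinrank N N' := by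
    rw [hrel]
    exact hp.pos
  -- `w^p ∈ N` for `w ∈ N'`
  have hpow : ∀ w ∈ N', w ^ p ∈ N := fun w hw =>
    pow_mem_of_purelyInseparable_of_finrank_eq p hNN' hdeg hw
  -- `N|K(x)` is separable: `N|H` (unramified) and `H|K(x)` (henselization) are
  have hsep : ∀ z ∈ N, IsSeparable Kx z := by
    intro z hz
    have h1 : IsSeparable H z := hunr.isSeparable V hz
    let H' : IntermediateField Kx Ω := Subfield.extendScalars hKxH
    haveI : Algebra.IsSeparable Kx H' := ⟨fun y => by
      have hy : IsSeparable Kx (y : Ω) :=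
        isSeparable_of_mem_henselization V Kx ((Subfield.mem_extendScalars (h := hKxH)).mp y.2)
      exact (isSeparable_map_iff (IsScalarTower.toAlgHom Kx H' Ω) (algebraMap H' Ω).injective).mp hy⟩
    let e : H →+* H' :=
      { toFun := fun y => ⟨y.1, (Subfield.mem_extendScalars (h := hKxH)).mpr y.2⟩
        map_one' := rfl
        map_mul' := fun _ _ => rfl
        map_zero' := rfl
        map_add' := fun _ _ => rfl }
    letI : Algebra H H' := e.toAlgebra
    haveI : IsScalarTower H H' Ω := IsScalarTower.of_algebraMap_eq fun _ => rfl
    have h2 : IsSeparable H' z := IsSeparable.tower_top H' h1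
    exact IsSeparable.of_algebra_isSeparable_of_isSeparable (F := Kx) (E := H') h2
  -- `t = x^{1/p}` lies in `N'`
  obtain ⟨t, htx⟩ := IsAlgClosed.exists_pow_nat_eq x hp.pos
  have htp : t ^ p ∈ N := by
    rw [htx]
    exact hxN
  have hle : N' ≤ (IntermediateField.adjoin N ({t} : Set Ω)).toSubfield :=
    le_adjoin_of_pow_mem_of_isSeparable p hpow hsep (adjoin_le_map_frobenius p hp.pos hK hKN htx)
  have htN' : t ∈ N' := mem_of_le_adjoin_of_finrank_eq p hNN' hdeg htp hle
  -- residues: `t̄^p = x̄`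
  have hxV : x ∈ V := hx.mem
  have htV : t ∈ V := mem_of_pow_mem hp.ne_zero (by rw [htx]; exact hxV)
  have hres_t : residue V ⟨t, htV⟩ ∈ residueSubfield N' V := by
    rw [residueSubfield_subfield_eq_resField]
    exact residue_mem_resField V ⟨t, htV⟩ htN'
  have hres_x : residue V ⟨x, hxV⟩ ∈ residueSubfield N V := by
    rw [residueSubfield_subfield_eq_resField]
    exact residue_mem_resField V ⟨x, hxV⟩ hxN
  have hres_pow : (residue V ⟨t, htV⟩) ^ p = residue V ⟨x, hxV⟩ := by
    rw [← map_pow]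
    congr 1
    exact Subtype.ext htx
  have hnot : ∀ s ∈ residueSubfield N V, s ^ p ≠ residue V ⟨x, hxV⟩ := fun s hs =>
    residue_pow_ne_of_isResidueTranscendental V p hp hx hunr hs
  -- the fundamental inequality `e·f ≤ p`
  obtain ⟨-, hf, hef⟩ := relIndex_mul_relfinrank_le_relfinrank V hNN' hpos
  -- `e = 1`: `vN' = vK = vN`
  have he1 : (valueSubgroup N V).relIndex (valueSubgroup N' V) = 1 := by
    have hN : IsHenselizedInertiallyGeneratedRT V K N := ⟨x, hx, hr1, hunr⟩
    rw [hN.valueSubgroup_eq, hN.valueSubgroup_eq_of_algebraic hK hNN'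
      (fun a ha => isAlgebraic_of_relfinrank_pos hNN' hpos ha), Subgroup.relIndex_self]
  -- `f ≥ p`: `Nv(t̄) ≤ N'v` has degree `p` over `Nv`
  have hfp : p ≤ (residueSubfield N V).relfinrank (residueSubfield N' V) := by
    have hAB : residueSubfield N V ≤ residueSubfield N' V := residueSubfield_subfield_mono hNN'
    rw [Subfield.relfinrank_eq_finrank_of_le hAB] at hf ⊢
    haveI : FiniteDimensional (residueSubfield N V) (Subfield.extendScalars hAB) :=
      Module.finite_of_finrank_pos hf
    have hnotin : residue V ⟨t, htV⟩ ∉ (algebraMap (residueSubfield N V) (ResidueField V)).range := by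
      rintro ⟨s, hs⟩
      exact hnot s s.2 (by rw [← hres_pow, ← hs]; rfl)
    have hfin : Module.finrank (residueSubfield N V)
        (IntermediateField.adjoin (residueSubfield N V) ({residue V ⟨t, htV⟩} : Set (ResidueField V))) = p :=
      finrank_adjoin_simple_eq_of_not_mem_range p (F := residueSubfield N V)
        (c := ⟨residue V ⟨x, hxV⟩, hres_x⟩) hres_pow.symm hnotin
    have hadj : IntermediateField.adjoin (residueSubfield N V) ({residue V ⟨t, htV⟩} : Set (ResidueField V)) ≤
        Subfield.extendScalars hAB :=
      IntermediateField.adjoin_simple_le_iff.mpr ((Subfield.mem_extendScalars (h := hAB)).mpr hres_t)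
    rw [← hfin]
    exact IntermediateField.finrank_le_of_le_right hadj
  -- conclusion
  refine ⟨hNN', hpos, ?_⟩
  rw [he1, one_mul, hrel] at hef
  rw [hrel, he1, one_mul]
  exact le_antisymm hfp hef

end Main

/-! ### Discharge of the named fact -/

/-- **DISCHARGE of `Kuhlmann2010PurelyInseparableDegreePDefectless`** (Kuhlmann 2010, p. 20 with
Prop. 3.1, Thm. 2.14, Lemma 2.3: purely inseparable extensions of degree `p` of a henselized
inertially generated function field of rank one with a residue-transcendental generator over an
algebraically closed field are defectless). PROVED (`isDefectlessExtension_of_purelyInseparable`).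
[cite: Kuhlmann2010, Prop. 3.1, Thm. 2.14 and Lemma 2.3 (with Section 5 p. 20)] -/
theorem Kuhlmann2010PurelyInseparableDegreePDefectless_holds :
    Kuhlmann2010PurelyInseparableDegreePDefectless.{u} := by
  intro Ω _ _ V p _ hp K N N' hK hN hstep
  obtain ⟨hle, hdeg, hpi⟩ := hstep
  exact isDefectlessExtension_of_purelyInseparable V hp hK hN hle hdeg hpi

/-- **The named fact `Kuhlmann2010NormalDegreePDefectless` now rests on Cor. 4.2 alone**: from
`Kuhlmann2010GaloisDegreePDefectless` (the Galois steps) by `of_cases` and the discharged purely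
inseparable case. PROVED. [cite: Kuhlmann2010, Section 5, proof of (R4) (p. 20), with Cor. 4.2] -/
theorem Kuhlmann2010NormalDegreePDefectless.of_galois
    (hG : Kuhlmann2010GaloisDegreePDefectless.{u}) : Kuhlmann2010NormalDegreePDefectless.{u} :=
  Kuhlmann2010NormalDegreePDefectless.of_cases hG Kuhlmann2010PurelyInseparableDegreePDefectless_holds

end Literature.AlgebraicGeometry.Resolution
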